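import Summits.HubbardSuperconductivity.HubbardSuperconductivity.Theses.WeakCouplingBCS
import Literature.MathematicalPhysics.QuantumLattice.FinDimSpectrum
import Literature.MathematicalPhysics.QuantumLattice.PairCorrelationsProofs

/-!
# Crux `WcbcsSsbToTorusLRO` (item `stmt-HubbardSuperconductivity-2009`): SCHUR RIGIDITY of the every-ground-state
pair order — support from the standing disprover (generation 5)

The summit matrix (conclusion of the crux) is an EVERY-ground-state statement; sourced / quenched levers give at best
SOME good state. The gap between the two is the spread of the pair-order density
`lro ψ = L⁻⁴ re⟨ψ, P†P ψ⟩` (`P = pairField dWaveFormFactor L`) over the unit vectors of the source-free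
`(N, S^z = 0)` sector ground space `E₀ = szSector N 0 ⊓ ker(H - E_min)` of `hubbardTorus 2 L 1 U`. This file proves,
on the literal objects and without definitions (the ground space and the projection are local notation):

* `schur_compression_scalar` — Schur's lemma for the compression of a Hermitian form: for a Hermitian matrix `A`, a
  subspace `K` and a set `S` of matrices commuting with `A`, preserving `K` together with their adjoints, and acting on
  `K` with no proper non-zero invariant subspace, `⟨w, A v⟩ = c ⟨w, v⟩` on `K` (via the orthogonal projection matrix
  `Literature.MathematicalPhysics.QuantumLattice.projMatrix` and `Matrix.IsHermitian.exists_eigenvector_of_ne_zero`);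
* `lro_eq_of_groundSpaceIrreducible` — if `E₀` is irreducible in that sense for matrices commuting with `P†P` (e.g. the
  unitaries of the space group `ℤ_L² ⋊ D₄` and of the `S^z`-preserving spin symmetries, under which `Δ_d†Δ_d` is
  invariant, when `E₀` is a single irreducible multiplet), then ALL unit ground vectors have the same `lro`:
  symmetry-FORCED degeneracy costs nothing, only ACCIDENTAL multiplicity can lower the every-ground-state order;
* `spread_le_of_irreducible` — hence the spread inequality of the disprover's `PairOrderRigidity` at that side;
* `groundSpaceIrreducible_of_simpleAt` — simplicity (all ground vectors proportional) is the case `S = ∅`.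

So the spectral hypothesis a line should FILE is irreducibility (multiplicity-free symmetry content of the ground
multiplet), not uniqueness of the sector ground state. Workfile: `Cruxes/WcbcsSsbToTorusLRO/DisproofRound2.lean`
§18/§18b. Elementary linear algebra (Schur's lemma). [folklore]
-/

noncomputable section

namespace Summit.HubbardSuperconductivity.WcbcsSsbToTorusLRO.Negative

open Matrix Literature.MathematicalPhysics.QuantumLattice
open scoped Matrix ComplexOrder

section Schur

variable {n : Type*} [Fintype n] [DecidableEq n]

/-- The submodule `K ≤ ℂⁿ` transported to `EuclideanSpace ℂ n`. -/
local notation "toEuc[" K "]" =>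
  (Submodule.map (LinearEquiv.toLinearMap (LinearEquiv.symm (WithLp.linearEquiv 2 ℂ (n → ℂ)))) K :
    Submodule ℂ (EuclideanSpace ℂ n))
/-- The orthogonal projection matrix onto `K ≤ ℂⁿ`. -/
local notation "proj[" K "]" => (projMatrix toEuc[K])

omit [DecidableEq n] in
/-- Adjoint identity for the `star`-dot pairing: `⟨w, M y⟩ = ⟨Mᴴ w, y⟩`. [folklore] -/
theorem star_dotProduct_mulVec (M : Matrix n n ℂ) (w y : n → ℂ) :
    star w ⬝ᵥ M *ᵥ y = star (Mᴴ *ᵥ w) ⬝ᵥ y := by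
  rw [dotProduct_mulVec, star_mulVec, conjTranspose_conjTranspose]

omit [Fintype n] [DecidableEq n] in
/-- Membership in the transported submodule. [folklore] -/
theorem mem_toEuc_iff (K : Submodule ℂ (n → ℂ)) (y : EuclideanSpace ℂ n) : y ∈ toEuc[K] ↔ (WithLp.ofLp y) ∈ K := by
  rw [Submodule.mem_map_equiv]
  simp

omit [Fintype n] [DecidableEq n] in
/-- Membership in the transported submodule, `toLp` form. [folklore] -/
theorem toLp_mem_toEuc_iff (K : Submodule ℂ (n → ℂ)) (v : n → ℂ) :
    (WithLp.toLp 2 v : EuclideanSpace ℂ n) ∈ toEuc[K] ↔ v ∈ K := by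
  rw [mem_toEuc_iff]

/-- The projection matrix is Hermitian. [folklore] -/
theorem proj_isHermitian (K : Submodule ℂ (n → ℂ)) : proj[K].IsHermitian := projMatrix_isHermitian _

/-- The projection matrix maps into `K`. [folklore] -/
theorem proj_mulVec_mem (K : Submodule ℂ (n → ℂ)) (x : n → ℂ) : proj[K] *ᵥ x ∈ K := by
  have h := projMatrix_mulVec toEuc[K] (WithLp.toLp 2 x)
  have hx : ((WithLp.toLp 2 x : EuclideanSpace ℂ n) : n → ℂ) = x := rfl
  rw [hx] at h
  rw [h, ← mem_toEuc_iff]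
  exact Submodule.starProjection_apply_mem _ _

/-- The projection matrix fixes `K`. [folklore] -/
theorem proj_mulVec_of_mem (K : Submodule ℂ (n → ℂ)) {v : n → ℂ} (hv : v ∈ K) : proj[K] *ᵥ v = v := by
  have h := projMatrix_mulVec toEuc[K] (WithLp.toLp 2 v)
  have hx : ((WithLp.toLp 2 v : EuclideanSpace ℂ n) : n → ℂ) = v := rfl
  rw [hx] at h
  rw [h, Submodule.starProjection_eq_self_iff.mpr ((toLp_mem_toEuc_iff K v).2 hv)]

/-- `⟨w, Q y⟩ = ⟨w, y⟩` for `w ∈ K`. [folklore] -/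
theorem star_dotProduct_proj_mulVec (K : Submodule ℂ (n → ℂ)) {w : n → ℂ} (hw : w ∈ K) (y : n → ℂ) :
    star w ⬝ᵥ proj[K] *ᵥ y = star w ⬝ᵥ y := by
  rw [star_dotProduct_mulVec, (proj_isHermitian K).eq, proj_mulVec_of_mem K hw]

/-- **Schur's lemma for the compression of a Hermitian form to an irreducible invariant subspace.** [folklore] -/
theorem schur_compression_scalar (A : Matrix n n ℂ) (hA : A.IsHermitian) (K : Submodule ℂ (n → ℂ))
    (S : Set (Matrix n n ℂ)) (hcomm : ∀ g ∈ S, g * A = A * g)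
    (hK : ∀ g ∈ S, ∀ v ∈ K, g *ᵥ v ∈ K) (hKH : ∀ g ∈ S, ∀ v ∈ K, gᴴ *ᵥ v ∈ K)
    (hirr : ∀ W : Submodule ℂ (n → ℂ), W ≤ K → W ≠ ⊥ → (∀ g ∈ S, ∀ v ∈ W, g *ᵥ v ∈ W) → W = K) :
    ∃ c : ℂ, ∀ v ∈ K, ∀ w ∈ K, star w ⬝ᵥ A *ᵥ v = c * (star w ⬝ᵥ v) := by
  set Q := proj[K] with hQ
  set C := Q * A * Q with hC
  have hQh : Q.IsHermitian := proj_isHermitian K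
  have hCh : C.IsHermitian := by
    change (Q * A * Q)ᴴ = Q * A * Q
    rw [conjTranspose_mul, conjTranspose_mul, hQh.eq, hA.eq, Matrix.mul_assoc]
  -- key identity: the form of `A` on `K` is the form of `C`
  have hkey : ∀ v ∈ K, ∀ w ∈ K, star w ⬝ᵥ A *ᵥ v = star w ⬝ᵥ C *ᵥ v := by
    intro v hv w hw
    rw [hC, ← mulVec_mulVec, ← mulVec_mulVec, proj_mulVec_of_mem K hv, star_dotProduct_proj_mulVec K hw]
  by_cases hC0 : C = 0
  · refine ⟨0, fun v hv w hw => ?_⟩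
    rw [hkey v hv w hw, hC0, zero_mulVec, dotProduct_zero, zero_mul]
  obtain ⟨u, t, ht, hu, hCu⟩ := hCh.exists_eigenvector_of_ne_zero hC0
  -- `u ∈ K`
  have huK : u ∈ K := by
    have h1 : C *ᵥ u ∈ K := by
      rw [hC, ← mulVec_mulVec, ← mulVec_mulVec]
      exact proj_mulVec_mem K _
    rw [hCu] at h1
    have h2 : (t⁻¹ : ℝ) • (t • u) ∈ K := K.smul_of_tower_mem _ h1
    rwa [smul_smul, inv_mul_cancel₀ ht, one_smul] at h2
  -- the eigen-submodule of the compression inside `K`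
  let W : Submodule ℂ (n → ℂ) :=
    { carrier := {v | v ∈ K ∧ ∀ w ∈ K, star w ⬝ᵥ A *ᵥ v = (t : ℂ) * (star w ⬝ᵥ v)}
      zero_mem' := ⟨K.zero_mem, fun w _ => by simp⟩
      add_mem' := by
        rintro a b ⟨haK, ha⟩ ⟨hbK, hb⟩
        refine ⟨K.add_mem haK hbK, fun w hw => ?_⟩
        rw [mulVec_add, dotProduct_add, dotProduct_add, ha w hw, hb w hw, mul_add]
      smul_mem' := by
        rintro c a ⟨haK, ha⟩
        refine ⟨K.smul_mem c haK, fun w hw => ?_⟩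
        rw [mulVec_smul, dotProduct_smul, dotProduct_smul, ha w hw, smul_eq_mul, smul_eq_mul]
        ring }
  have hWK : W ≤ K := fun v hv => hv.1
  have huW : u ∈ W := by
    refine ⟨huK, fun w hw => ?_⟩
    rw [hkey u huK w hw, hCu, dotProduct_smul, Complex.real_smul]
  have hWne : W ≠ ⊥ := by
    intro h
    exact hu ((Submodule.eq_bot_iff W).1 h u huW)
  have hWinv : ∀ g ∈ S, ∀ v ∈ W, g *ᵥ v ∈ W := by
    rintro g hg v ⟨hvK, hv⟩
    refine ⟨hK g hg v hvK, fun w hw => ?_⟩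
    have hgA : A *ᵥ (g *ᵥ v) = g *ᵥ (A *ᵥ v) := by
      rw [mulVec_mulVec, mulVec_mulVec, hcomm g hg]
    rw [hgA, star_dotProduct_mulVec g, hv _ (hKH g hg w hw), ← star_dotProduct_mulVec g]
  have hWeq : W = K := hirr W hWK hWne hWinv
  refine ⟨(t : ℂ), fun v hv w hw => ?_⟩
  have hvW : v ∈ W := by rw [hWeq]; exact hv
  exact hvW.2 w hw


end Schur

section Rigidity

variable (L : ℕ) [NeZero L]

/-- The source-free `(N, S^z = 0)` sector ground space of `hubbardTorus 2 L 1 U` (ground vectors and `0`). -/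
local notation "E0[" L ", " U ", " N "]" =>
  (szSector N 0 ⊓ Module.End.eigenspace (Matrix.toLin' (hubbardTorus 2 L 1 U))
    ((Matrix.minEnergyOn (hubbardTorus 2 L 1 U) (szSector N 0) : ℝ) : ℂ) : Submodule ℂ (Fock (Orb (FermionTorus 2 L))))

/-- `L⁻⁴ re⟨φ, P†P φ⟩`, the pair-order density (as in the disprover's workfile). -/
local notation "lro[" L ", " φ "]" =>
  (Complex.re (expect ((pairField dWaveFormFactor L)ᴴ * pairField dWaveFormFactor L) φ) / (L : ℝ) ^ 4)

omit [NeZero L] in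
/-- Sector ground states are the non-zero vectors of the sector ground space. [folklore] -/
theorem isGroundStateInSector_iff_mem (U : ℝ) (N : ℕ) (ψ : Fock (Orb (FermionTorus 2 L))) :
    IsGroundStateInSector (hubbardTorus 2 L 1 U) N 0 ψ ↔ ψ ∈ E0[L, U, N] ∧ ψ ≠ 0 := by
  rw [IsGroundStateInSector, Submodule.mem_inf, Module.End.mem_eigenspace_iff, Matrix.toLin'_apply]
  tauto

/-- **Schur rigidity at one side**: if the sector ground space is irreducible in the above sense, ALL its unit
vectors have the same pair-order density (`= re c / L⁴` for Schur's scalar `c`). Symmetry-FORCED degeneracy costs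
nothing; only accidental multiplicity can lower the every-GS order. [folklore] -/
theorem lro_eq_of_groundSpaceIrreducible {U : ℝ} {N : ℕ} (h : (∃ S : Set (Matrix (Finset (Orb (FermionTorus 2 L))) (Finset (Orb (FermionTorus 2 L))) ℂ),
    (∀ g ∈ S, g * ((pairField dWaveFormFactor L)ᴴ * pairField dWaveFormFactor L) = ((pairField dWaveFormFactor L)ᴴ * pairField dWaveFormFactor L) * g) ∧
    (∀ g ∈ S, ∀ v ∈ E0[L, U, N], g *ᵥ v ∈ E0[L, U, N]) ∧
    (∀ g ∈ S, ∀ v ∈ E0[L, U, N], gᴴ *ᵥ v ∈ E0[L, U, N]) ∧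
    (∀ W : Submodule ℂ (Fock (Orb (FermionTorus 2 L))), W ≤ E0[L, U, N] → W ≠ ⊥ →
      (∀ g ∈ S, ∀ v ∈ W, g *ᵥ v ∈ W) → W = E0[L, U, N])))
    {ψ ψ' : Fock (Orb (FermionTorus 2 L))} (hψ : IsGroundStateInSector (hubbardTorus 2 L 1 U) N 0 ψ)
    (hψ1 : star ψ ⬝ᵥ ψ = 1) (hψ' : IsGroundStateInSector (hubbardTorus 2 L 1 U) N 0 ψ')
    (hψ'1 : star ψ' ⬝ᵥ ψ' = 1) : lro[L, ψ] = lro[L, ψ'] := by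
  obtain ⟨S, hcomm, hK, hKH, hirr⟩ := h
  obtain ⟨c, hc⟩ := schur_compression_scalar ((pairField dWaveFormFactor L)ᴴ * pairField dWaveFormFactor L) (isHermitian_conjTranspose_mul_self _)
    E0[L, U, N] S hcomm hK hKH hirr
  have e : ∀ φ, IsGroundStateInSector (hubbardTorus 2 L 1 U) N 0 φ → star φ ⬝ᵥ φ = 1 →
      lro[L, φ] = c.re / (L : ℝ) ^ 4 := by
    intro φ hφ hφ1
    have hmem := ((isGroundStateInSector_iff_mem L U N φ).1 hφ).1
    unfold expect
    rw [hc φ hmem φ hmem, hφ1, mul_one]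
  rw [e ψ hψ hψ1, e ψ' hψ' hψ'1]

/-- Hence, at that side, any two unit ground vectors have spread `≤ ε` for every `ε ≥ 0` — the inequality
quantified in the disprover's `PairOrderRigidity` (workfile §11), with the spread in fact `0`. [folklore] -/
theorem spread_le_of_irreducible {U : ℝ} {N : ℕ} (h : (∃ S : Set (Matrix (Finset (Orb (FermionTorus 2 L))) (Finset (Orb (FermionTorus 2 L))) ℂ),
    (∀ g ∈ S, g * ((pairField dWaveFormFactor L)ᴴ * pairField dWaveFormFactor L) = ((pairField dWaveFormFactor L)ᴴ * pairField dWaveFormFactor L) * g) ∧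
    (∀ g ∈ S, ∀ v ∈ E0[L, U, N], g *ᵥ v ∈ E0[L, U, N]) ∧
    (∀ g ∈ S, ∀ v ∈ E0[L, U, N], gᴴ *ᵥ v ∈ E0[L, U, N]) ∧
    (∀ W : Submodule ℂ (Fock (Orb (FermionTorus 2 L))), W ≤ E0[L, U, N] → W ≠ ⊥ →
      (∀ g ∈ S, ∀ v ∈ W, g *ᵥ v ∈ W) → W = E0[L, U, N])))
    {ε : ℝ} (hε : 0 ≤ ε) {ψ ψ' : Fock (Orb (FermionTorus 2 L))}
    (hψ : IsGroundStateInSector (hubbardTorus 2 L 1 U) N 0 ψ) (hψ1 : star ψ ⬝ᵥ ψ = 1)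
    (hψ' : IsGroundStateInSector (hubbardTorus 2 L 1 U) N 0 ψ') (hψ'1 : star ψ' ⬝ᵥ ψ' = 1) :
    lro[L, ψ'] - lro[L, ψ] ≤ ε := by
  rw [lro_eq_of_groundSpaceIrreducible L h hψ hψ1 hψ' hψ'1, sub_self]
  exact hε

/-- Simplicity is the special case `S = ∅`: a ground space all of whose ground vectors are proportional has no
proper non-zero subspace at all. So `pairOrderRigidity_of_irreducible` generalises `pairOrderRigidity_of_simple`. [folklore] -/
theorem groundSpaceIrreducible_of_simpleAt {U : ℝ} {N : ℕ}
    (h : ∀ ψ ψ' : Fock (Orb (FermionTorus 2 L)), IsGroundStateInSector (hubbardTorus 2 L 1 U) N 0 ψ →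
      IsGroundStateInSector (hubbardTorus 2 L 1 U) N 0 ψ' → ∃ c : ℂ, ψ' = c • ψ) :
    (∃ S : Set (Matrix (Finset (Orb (FermionTorus 2 L))) (Finset (Orb (FermionTorus 2 L))) ℂ),
    (∀ g ∈ S, g * ((pairField dWaveFormFactor L)ᴴ * pairField dWaveFormFactor L) = ((pairField dWaveFormFactor L)ᴴ * pairField dWaveFormFactor L) * g) ∧
    (∀ g ∈ S, ∀ v ∈ E0[L, U, N], g *ᵥ v ∈ E0[L, U, N]) ∧
    (∀ g ∈ S, ∀ v ∈ E0[L, U, N], gᴴ *ᵥ v ∈ E0[L, U, N]) ∧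
    (∀ W : Submodule ℂ (Fock (Orb (FermionTorus 2 L))), W ≤ E0[L, U, N] → W ≠ ⊥ →
      (∀ g ∈ S, ∀ v ∈ W, g *ᵥ v ∈ W) → W = E0[L, U, N])) := by
  refine ⟨∅, by simp, by simp, by simp, fun W hWK hWne _ => ?_⟩
  refine le_antisymm hWK fun v hv => ?_
  by_cases hv0 : v = 0
  · rw [hv0]; exact W.zero_mem
  obtain ⟨u, huW, hu0⟩ := (Submodule.ne_bot_iff W).1 hWne
  obtain ⟨c, hc⟩ := h u v ((isGroundStateInSector_iff_mem L U N u).2 ⟨hWK huW, hu0⟩)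
    ((isGroundStateInSector_iff_mem L U N v).2 ⟨hv, hv0⟩)
  rw [hc]
  exact W.smul_mem c huW

end Rigidity

end Summit.HubbardSuperconductivity.WcbcsSsbToTorusLRO.Negative

end
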